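import Literature.Barriers.PneNP.LowDegreeCounterexamples
import Literature.Computability.Complexity.LongCodeFourier

-- LOG (stub worker S2): v2 — no `def`s (kind=proof), Walsh algebra from `LongCodeFourier`; next: land.

/-!
# `AcZeroRung` (stmt-QuantumAdvantage-2425), line `dyadic-chirp-poisson` — stub `stub_almostToExact`

**Alon–Goldreich–Mansour 2003, Thm. 2.1** ("almost `K`-wise independence versus `K`-wise
independence") on the Boolean cube `{0,1}ⁿ`, over the tree vocabulary `charMean` / `walsh` / `sgn`
(`Literature.Probability.RandomGraphs.LowDegree`) and `IsDWiseIndependent`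
(`Literature.Barriers.PneNP.LowDegreeCounterexamples`): if every nonempty Walsh bias of weight
`≤ K` of `μ` is at most `γ` in absolute value, then `μ` is within `L¹`-distance
`2γ Σ_{1 ≤ i ≤ K} C(n,i)` of an EXACTLY `K`-wise independent `μ'` (consumed verbatim, as a
hypothesis, by `stub_subcubeTransfer` of the line).

## Proof (the AGM construction, `AlmostToExact.exists_unbiased_near`)

Let `𝒯 = {T ≠ ∅, |T| ≤ K}`, `b_T = E_μ[χ_T]`, `B = Σ_{T ∈ 𝒯} |b_T|`. For `T ∈ 𝒯` let
`σ_T = -sign(b_T) ∈ {±1}` and `h_T = (1 + σ_T χ_T) / 2ⁿ`, the uniform density on the half-cube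
`{χ_T = σ_T}`: it has mass `1` and `E_{h_T}[χ_{T'}] = σ_T [T = T']` for `T' ≠ ∅` (from
`Σ_x χ_U(x) = 2ⁿ [U = ∅]` and `Σ_x χ_T χ_{T'} = 2ⁿ [T = T']`, the tree's `LongCode.sum_walsh`,
`LongCode.sum_walsh_mul_walsh_pts`). Then `f = (μ + Σ_{T ∈ 𝒯} |b_T| h_T) / (1 + B)` is a
probability density with `E_f[χ_{T'}] = (b_{T'} + |b_{T'}| σ_{T'}) / (1 + B) = 0` for `T' ∈ 𝒯` and
`‖μ − f‖₁ = ‖B μ − Σ_T |b_T| h_T‖₁ / (1 + B) ≤ 2B / (1 + B) ≤ 2B ≤ 2γ #𝒯 ≤ 2γ Σ_{i=1}^{K} C(n,i)`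
(`card_tests_le`). Finally, vanishing Walsh biases up to weight `K` give exact `K`-wise
independence (`isDWiseIndependent_of_charMean_eq_zero`, Fourier inversion on the sub-cube
`{0,1}^S` via the tree's `sum_walsh_mul_walsh`; the converse of the tree's
`IsDWiseIndependent.charMean_eq_zero`).

Reference: N. Alon, O. Goldreich, Y. Mansour, *Almost k-wise independence versus k-wise
independence*, Inform. Process. Lett. 88 (2003) 107–110, Thm. 2.1.
-/

set_option linter.dupNamespace false -- D-0017: single-problem summit ⇒ QuantumAdvantage.QuantumAdvantage by design

noncomputable section

namespace Summit.QuantumAdvantage.QuantumAdvantage.Theorems.AcZeroRung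

open Finset
open Literature.Probability.RandomGraphs.LowDegree
open Literature.Barriers.PneNP (IsDWiseIndependent sum_toReal_mul_comp)
open Literature.Computability.Complexity.LongCode (abs_walsh sum_walsh sum_walsh_mul_walsh_pts)

namespace AlmostToExact

variable {ι : Type} [Fintype ι]

/-- `#𝒯_K ≤ Σ_{i=1}^{K} C(|ι|, i)` for the AGM tests `𝒯_K = {T ≠ ∅, |T| ≤ K}` (in fact equality;
the inequality is all we need). -/
theorem card_tests_le (K : ℕ) :
    ((univ.filter fun T : Finset ι => T.Nonempty ∧ T.card ≤ K).card : ℝ) ≤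
      ∑ i ∈ Icc 1 K, ((Fintype.card ι).choose i : ℝ) := by
  classical
  have hsub : (univ.filter fun T : Finset ι => T.Nonempty ∧ T.card ≤ K) ⊆
      (Icc 1 K).biUnion fun i => powersetCard i (univ : Finset ι) := by
    intro T hT
    simp only [mem_filter, mem_univ, true_and] at hT
    simp only [mem_biUnion, mem_Icc, mem_powersetCard]
    exact ⟨T.card, ⟨card_pos.2 hT.1, hT.2⟩, subset_univ _, rfl⟩
  calc ((univ.filter fun T : Finset ι => T.Nonempty ∧ T.card ≤ K).card : ℝ)
      ≤ (((Icc 1 K).biUnion fun i => powersetCard i (univ : Finset ι)).card : ℝ) := by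
        exact_mod_cast card_le_card hsub
    _ ≤ ∑ i ∈ Icc 1 K, ((powersetCard i (univ : Finset ι)).card : ℝ) := by
        exact_mod_cast card_biUnion_le
    _ = ∑ i ∈ Icc 1 K, ((Fintype.card ι).choose i : ℝ) := by
        simp [card_powersetCard, card_univ]

variable [DecidableEq ι]

/-- `Σ_x χ_T(x) = 0` for nonempty `T`. -/
theorem sum_walsh_of_nonempty {T : Finset ι} (hT : T.Nonempty) :
    ∑ x : ι → Bool, walsh T x = 0 := by
  rw [sum_walsh, if_neg (nonempty_iff_ne_empty.1 hT)]

/-! ## The AGM sign and the half-cube densities -/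

omit [Fintype ι] [DecidableEq ι] in
/-- The AGM sign `σ(b) = -sign(b)` (with `σ(0) = -1`) has `b + |b| σ(b) = 0`. -/
theorem add_abs_mul_sign (b : ℝ) : b + |b| * (if 0 ≤ b then -1 else 1) = 0 := by
  split_ifs with h
  · rw [abs_of_nonneg h]; ring
  · rw [abs_of_neg (not_le.1 h)]; ring

omit [Fintype ι] [DecidableEq ι] in
/-- The half-cube weight `1 + s χ_T(x)` is nonnegative for `|s| = 1`. -/
theorem one_add_mul_walsh_nonneg {s : ℝ} (hs : |s| = 1) (T : Finset ι) (x : ι → Bool) :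
    0 ≤ 1 + s * walsh T x := by
  have h1 : |s * walsh T x| = 1 := by rw [abs_mul, hs, abs_walsh, one_mul]
  have h2 := neg_abs_le (s * walsh T x)
  linarith

/-- The half-cube density `h_{s,T} = (1 + s χ_T) / 2^{|ι|}` has mass `1` for `T ≠ ∅`. -/
theorem sum_halfDensity (s : ℝ) {T : Finset ι} (hT : T.Nonempty) :
    ∑ x : ι → Bool, (1 + s * walsh T x) / 2 ^ Fintype.card ι = 1 := by
  rw [← sum_div, sum_add_distrib, ← mul_sum, sum_walsh_of_nonempty hT, mul_zero, add_zero,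
    div_eq_one_iff_eq (by positivity)]
  simp

/-- `E_{h_{s,T}}[χ_{T'}] = s [T = T']` for `T' ≠ ∅`. -/
theorem sum_halfDensity_mul_walsh (s : ℝ) (T : Finset ι) {T' : Finset ι} (hT' : T'.Nonempty) :
    ∑ x : ι → Bool, (1 + s * walsh T x) / 2 ^ Fintype.card ι * walsh T' x =
      if T = T' then s else 0 := by
  simp_rw [div_mul_eq_mul_div, add_mul, one_mul, mul_assoc]
  rw [← sum_div, sum_add_distrib, ← mul_sum, sum_walsh_of_nonempty hT', zero_add,
    sum_walsh_mul_walsh_pts]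
  split_ifs
  · rw [mul_div_assoc, div_self (by positivity), mul_one]
  · rw [mul_zero, zero_div]

/-! ## The AGM distribution -/

/-- **The AGM distribution.** For every `μ` and `K` there is a distribution `μ'` whose Walsh
biases of weights `1 … K` vanish, with `‖μ − μ'‖₁ ≤ 2 Σ_{T ∈ 𝒯_K} |E_μ[χ_T]|`; namely
`μ' = (μ + Σ_{T ∈ 𝒯_K} |b_T| h_T) / (1 + B)` with `h_T` the uniform distribution on the half-cube
`{χ_T = -sign b_T}` and `B = Σ_{T ∈ 𝒯_K} |b_T|`. -/
theorem exists_unbiased_near (μ : PMF (ι → Bool)) (K : ℕ) :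
    ∃ μ' : PMF (ι → Bool), (∀ T : Finset ι, T.Nonempty → T.card ≤ K → charMean μ' T = 0) ∧
      ∑ x, |(μ x).toReal - (μ' x).toReal| ≤
        2 * ∑ T ∈ univ.filter (fun T : Finset ι => T.Nonempty ∧ T.card ≤ K), |charMean μ T| := by
  -- the tests `𝒯`, the total bias `B`, the signs `σ`, the correction `E`, the density `f`
  set 𝒯 := univ.filter (fun T : Finset ι => T.Nonempty ∧ T.card ≤ K) with h𝒯
  have mem𝒯 : ∀ {T : Finset ι}, T ∈ 𝒯 ↔ T.Nonempty ∧ T.card ≤ K := by simp [h𝒯]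
  set B := ∑ T ∈ 𝒯, |charMean μ T| with hB
  have hB0 : 0 ≤ B := sum_nonneg fun _ _ => abs_nonneg _
  have h1B : (0:ℝ) < 1 + B := by linarith
  have h1B' : (1 + B) ≠ 0 := h1B.ne'
  set σ : Finset ι → ℝ := fun T => if 0 ≤ charMean μ T then -1 else 1 with hσ
  have hσ1 : ∀ T, |σ T| = 1 := fun T => by
    simp only [hσ]
    split_ifs <;> simp
  have hσ0 : ∀ T, charMean μ T + |charMean μ T| * σ T = 0 := fun T => add_abs_mul_sign _
  set E : (ι → Bool) → ℝ := fun x =>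
    ∑ T ∈ 𝒯, |charMean μ T| * ((1 + σ T * walsh T x) / 2 ^ Fintype.card ι) with hE
  have hE0 : ∀ x, 0 ≤ E x := fun x => sum_nonneg fun T _ =>
    mul_nonneg (abs_nonneg _) (div_nonneg (one_add_mul_walsh_nonneg (hσ1 T) T x) (by positivity))
  have hEsum : ∑ x, E x = B := by
    simp only [hE]
    rw [sum_comm]
    refine sum_congr rfl fun T hT => ?_
    rw [← mul_sum, sum_halfDensity _ (mem𝒯.1 hT).1, mul_one]
  have hEwalsh : ∀ {T' : Finset ι}, T' ∈ 𝒯 →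
      ∑ x, E x * walsh T' x = |charMean μ T'| * σ T' := by
    intro T' hT'
    simp only [hE]
    simp_rw [sum_mul, mul_assoc]
    rw [sum_comm]
    simp_rw [← mul_sum, sum_halfDensity_mul_walsh _ _ (mem𝒯.1 hT').1, mul_ite, mul_zero,
      sum_ite_eq', if_pos hT']
  set f : (ι → Bool) → ℝ := fun x => ((μ x).toReal + E x) / (1 + B) with hf
  have hf0 : ∀ x, 0 ≤ f x := fun x =>
    div_nonneg (add_nonneg ENNReal.toReal_nonneg (hE0 x)) h1B.le
  have hfsum : ∑ x, f x = 1 := by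
    simp only [hf]
    rw [← sum_div, sum_add_distrib, sum_toReal_eq_one, hEsum]
    exact div_self h1B'
  have hfwalsh : ∀ {T' : Finset ι}, T' ∈ 𝒯 → ∑ x, f x * walsh T' x = 0 := by
    intro T' hT'
    simp only [hf]
    simp_rw [div_mul_eq_mul_div, add_mul]
    rw [← sum_div, sum_add_distrib, hEwalsh hT',
      show ∑ x, (μ x).toReal * walsh T' x = charMean μ T' from rfl, hσ0, zero_div]
  have hfl1 : ∑ x, |(μ x).toReal - f x| ≤ 2 * B := by
    have key : ∀ x, |(μ x).toReal - f x| ≤ (B * (μ x).toReal + E x) / (1 + B) := by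
      intro x
      have e : (μ x).toReal - f x = (B * (μ x).toReal - E x) / (1 + B) := by
        simp only [hf]
        field_simp
        ring
      rw [e, abs_div, abs_of_pos h1B]
      refine div_le_div_of_nonneg_right ?_ h1B.le
      calc |B * (μ x).toReal - E x| ≤ |B * (μ x).toReal| + |E x| := abs_sub _ _
        _ = B * (μ x).toReal + E x := by
            rw [abs_of_nonneg (mul_nonneg hB0 ENNReal.toReal_nonneg), abs_of_nonneg (hE0 x)]
    calc ∑ x, |(μ x).toReal - f x|
        ≤ ∑ x, (B * (μ x).toReal + E x) / (1 + B) := sum_le_sum fun x _ => key x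
      _ = 2 * B / (1 + B) := by
          rw [← sum_div, sum_add_distrib, ← mul_sum, sum_toReal_eq_one, hEsum]
          ring
      _ ≤ 2 * B := div_le_self (by linarith) (by linarith)
  -- the distribution `μ'` with density `f`
  have hsum1 : ∑ x, ENNReal.ofReal (f x) = 1 := by
    rw [← ENNReal.ofReal_sum_of_nonneg fun x _ => hf0 x, hfsum, ENNReal.ofReal_one]
  have hreal : ∀ x, (ENNReal.ofReal (f x)).toReal = f x := fun x => ENNReal.toReal_ofReal (hf0 x)
  refine ⟨PMF.ofFintype (fun x => ENNReal.ofReal (f x)) hsum1, fun T hT hTK => ?_, ?_⟩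
  · unfold charMean
    simp_rw [PMF.ofFintype_apply, hreal]
    exact hfwalsh (mem𝒯.2 ⟨hT, hTK⟩)
  · simp_rw [PMF.ofFintype_apply, hreal]
    exact hfl1

/-! ## Vanishing low-weight biases give exact bounded independence -/

omit [Fintype ι] [DecidableEq ι] in
/-- A Walsh character of the sub-cube `{0,1}^S`, read through the restriction map, is the Walsh
character of the cube indexed by the same set viewed inside `ι`. -/
theorem walsh_restrict (S : Finset ι) (U : Finset S) (x : ι → Bool) :
    walsh U (S.restrict x) = walsh (U.map (Function.Embedding.subtype _)) x :=
  (prod_map U (Function.Embedding.subtype _) fun i => sgn (x i)).symm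

/-- **Converse of `IsDWiseIndependent.charMean_eq_zero`.** If `E_P[χ_T] = 0` for every nonempty
`T` with `|T| ≤ K`, then every marginal of `P` on `≤ K` coordinates is uniform (Fourier inversion
on the sub-cube `{0,1}^S`: `[x|_S = y] = 2^{-|S|} Σ_{U ⊆ S} χ_U(x|_S) χ_U(y)`). -/
theorem isDWiseIndependent_of_charMean_eq_zero (K : ℕ) (P : PMF (ι → Bool))
    (h : ∀ T : Finset ι, T.Nonempty → T.card ≤ K → charMean P T = 0) :
    IsDWiseIndependent K P := by
  intro S hS
  ext y
  apply (ENNReal.toReal_eq_toReal_iff' (PMF.apply_ne_top _ _) (PMF.apply_ne_top _ _)).1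
  have hL : ((P.map S.restrict) y).toReal =
      ∑ x, (P x).toReal * (if S.restrict x = y then (1:ℝ) else 0) := by
    have e := sum_toReal_mul_comp P S.restrict (fun z => if z = y then (1:ℝ) else 0)
    beta_reduce at e
    rw [e]
    simp_rw [mul_ite, mul_one, mul_zero]
    rw [sum_ite_eq', if_pos (mem_univ _)]
  have hR : ((PMF.uniformOfFintype (S → Bool)) y).toReal = ((2:ℝ) ^ S.card)⁻¹ := by
    rw [PMF.uniformOfFintype_apply, ENNReal.toReal_inv, ENNReal.toReal_natCast, Fintype.card_fun,
      Fintype.card_bool, Fintype.card_coe]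
    push_cast
    rfl
  rw [hL, hR]
  have hind : ∀ x : ι → Bool, (if S.restrict x = y then (1:ℝ) else 0) =
      ((2:ℝ) ^ S.card)⁻¹ * ∑ U : Finset S, walsh U (S.restrict x) * walsh U y := by
    intro x
    rw [sum_walsh_mul_walsh (S.restrict x) y, Fintype.card_coe]
    split_ifs
    · rw [inv_mul_cancel₀ (by positivity)]
    · rw [mul_zero]
  simp_rw [hind]
  calc ∑ x, (P x).toReal * (((2:ℝ) ^ S.card)⁻¹ * ∑ U : Finset S, walsh U (S.restrict x) * walsh U y)
      = ((2:ℝ) ^ S.card)⁻¹ * ∑ U : Finset S, walsh U y *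
          ∑ x, (P x).toReal * walsh (U.map (Function.Embedding.subtype _)) x := by
        simp_rw [mul_sum]
        rw [sum_comm]
        refine sum_congr rfl fun U _ => sum_congr rfl fun x _ => ?_
        rw [walsh_restrict]
        ring
    _ = ((2:ℝ) ^ S.card)⁻¹ * ∑ U : Finset S, walsh U y * (if U = ∅ then (1:ℝ) else 0) := by
        congr 1
        refine sum_congr rfl fun U _ => ?_
        congr 1
        split_ifs with hU
        · subst hU
          rw [Finset.map_empty]
          simp_rw [walsh_empty, mul_one]
          exact sum_toReal_eq_one P
        · refine h _ (map_nonempty.2 (nonempty_iff_ne_empty.2 hU)) ?_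
          rw [card_map]
          exact (card_le_univ U).trans ((Fintype.card_coe S).le.trans hS)
    _ = ((2:ℝ) ^ S.card)⁻¹ := by simp

end AlmostToExact

open AlmostToExact

/-- **S2 · `stub_almostToExact` — Alon–Goldreich–Mansour 2003, Thm. 2.1** (almost `K`-wise
independence ⇒ `L¹`-close to exactly `K`-wise independent): if every nonempty Walsh bias of
weight `≤ K` of `μ` is `≤ γ` in absolute value, then some `K`-wise independent `μ'` has
`‖μ − μ'‖₁ ≤ 2γ Σ_{1 ≤ i ≤ K} C(n,i)`. The witness is the AGM distribution
`μ' ∝ μ + Σ_T |b_T| · (uniform on the half-cube where χ_T = −sign b_T)`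
(`AlmostToExact.exists_unbiased_near`), which is `K`-wise independent by
`AlmostToExact.isDWiseIndependent_of_charMean_eq_zero`. -/
theorem stub_almostToExact :
    ∀ (n K : ℕ) (γ : ℝ) (μ : PMF (Fin n → Bool)), 0 ≤ γ →
      (∀ T : Finset (Fin n), T.Nonempty → T.card ≤ K → |charMean μ T| ≤ γ) →
      ∃ μ' : PMF (Fin n → Bool), IsDWiseIndependent K μ' ∧
        ∑ x, |(μ x).toReal - (μ' x).toReal| ≤ 2 * γ * ∑ i ∈ Finset.Icc 1 K, (n.choose i : ℝ) := by
  intro n K γ μ hγ hb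
  obtain ⟨μ', hμ', hdist⟩ := exists_unbiased_near μ K
  refine ⟨μ', isDWiseIndependent_of_charMean_eq_zero K μ' hμ', hdist.trans ?_⟩
  have hcard := card_tests_le (ι := Fin n) K
  rw [Fintype.card_fin] at hcard
  have hmass : ∑ T ∈ univ.filter (fun T : Finset (Fin n) => T.Nonempty ∧ T.card ≤ K),
      |charMean μ T| ≤ γ * ∑ i ∈ Finset.Icc 1 K, (n.choose i : ℝ) := by
    calc ∑ T ∈ univ.filter (fun T : Finset (Fin n) => T.Nonempty ∧ T.card ≤ K), |charMean μ T|
        ≤ ∑ T ∈ univ.filter (fun T : Finset (Fin n) => T.Nonempty ∧ T.card ≤ K), γ :=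
          sum_le_sum fun T hT => by
            simp only [mem_filter, mem_univ, true_and] at hT
            exact hb T hT.1 hT.2
      _ = γ * ((univ.filter fun T : Finset (Fin n) => T.Nonempty ∧ T.card ≤ K).card : ℝ) := by
          rw [sum_const, nsmul_eq_mul, mul_comm]
      _ ≤ γ * ∑ i ∈ Finset.Icc 1 K, (n.choose i : ℝ) := mul_le_mul_of_nonneg_left hcard hγ
  calc 2 * ∑ T ∈ univ.filter (fun T : Finset (Fin n) => T.Nonempty ∧ T.card ≤ K), |charMean μ T|
      ≤ 2 * (γ * ∑ i ∈ Finset.Icc 1 K, (n.choose i : ℝ)) := by linarith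
    _ = 2 * γ * ∑ i ∈ Finset.Icc 1 K, (n.choose i : ℝ) := by ring

end Summit.QuantumAdvantage.QuantumAdvantage.Theorems.AcZeroRung

end
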